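import Summits.BirchSwinnertonDyer.BirchSwinnertonDyer.Theorems.EisensteinDepletionAtTwoStarEisFiniteLevel
import Summits.BirchSwinnertonDyer.BirchSwinnertonDyer.Theorems.EisensteinDepletionAtTwoStarGlueFin
import HarnessLib

/-!
# Route `EisensteinDepletionAtTwo`, crux E1M `DepletedLambdaLawAtTwoMod` (item stmt-BirchSwinnertonDyer-20341),
# line `star` — **(★-core) from the research stub ALONE, in the `8`-normalisation**:
# `StarSymbC8 → StarCoreAtTwo` (both unfolded over tree names)

Cell `bsd-rank2`, seat `bsd-rank2-eng-2` GEN 8. THEOREMS ONLY — no definition, no named fact, no `sorry`. HONEST FRAMING: modus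
ponens of the two finite-level theorems `starEisFin` (Eisenstein half, PROVED) and `sq_X_mul_red_pfree_eq_of_cuspCongruence8`
(glue, PROVED): the ONLY remaining input of (★-core) — hence of (★), E1 and the crux E1M on line `star` — is the mod-2 cusp
congruence (★-SymbC8) below (p2's C-test in the `8`-normalisation on the Eisenstein side: on `C = {(m,a) : m ≥ 3, a ≡ 1 (4),
1 < a < 2ᵐ}`, `([a/2ᵐ]⁺_f − [1/2ᵐ]⁺_f)/g ∈ ℤ` is congruent to `stabEisCuspDiff N_W β m a / 8` modulo `2ℤ₂` for some admissible `β`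
and some scale `g ≠ 0`), which is RESEARCH and is NOT proved here; nothing reads an analytic rank; BSD is not proved by any of this
(PARTITION D-0054: none — r_an ≥ 2 axis S0, door T-r3₂). For the lead: in `Cruxes/…/Lines/star.lean` register
`stub_starSymbC8 : StarSymbC8` (the hypothesis of `starCore_of_cuspCongruence8`, verbatim) and close `stub_starCore` by
`starCore_of_cuspCongruence8 stub_starSymbC8` after unfolding (`StarCoreAtTwo`, `frobeniusMinusOne`, and the skeleton's local
`stabEisCuspDiff`/`IsAdmissibleStabData`/`plusCuspDiff`, which agree with `Theorems/…StarDefs.lean` by `rfl` since v2.2).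
Numerically (★-SymbC8) is p2's C-test (110/110 habitat curves, kit j283037/j283107/j283231; the `2`-content of `stabEisCuspDiff`
on `C` is `2³` on all data of evidence #39, so the `8`-normalisation IS the primitive one).

* **`starCore_of_cuspCongruence8`**.

References: B. Mazur, J. Tate, J. Teitelbaum, Invent. Math. 84 (1986), §I.10–I.13 [MazurTateTeitelbaum1986Invent]; G. Stevens,
*Arithmetic on Modular Curves* (1982), §5.4 [Stevens1982]; R. Greenberg, V. Vatsal, Invent. Math. 142 (2000), §3 Thm. (3.12) [GreenbergVatsal2000].
-/

set_option linter.dupNamespace false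
set_option autoImplicit false

noncomputable section

open scoped Classical
open scoped MatrixGroups

open Filter Topology CongruenceSubgroup _root_.WeierstrassCurve
  Literature.NumberTheory.EllipticCurves Literature.NumberTheory.EllipticCurves.ModularForms
  Literature.NumberTheory.EllipticCurves.Greenberg1999 Literature.NumberTheory.EllipticCurves.GreenbergVatsal2000
  Summit.BirchSwinnertonDyer.Rank1Residual.X1 Summit.BirchSwinnertonDyer.Rank1Residual.X1.MuLambda

namespace Summit.BirchSwinnertonDyer.BirchSwinnertonDyer.Theorems.DepletionAtTwo

/-- **(★-core) from (★-SymbC8) alone.** If for every `W/ℚ` globally minimal, good ordinary at `2`, with a unique rational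
`2`-torsion point of Greenberg type A xor B, and every newform `f` of `W`, there are admissible stabilisation data `β` at level
`N_W` and a scale `g ≠ 0` such that on `C` the numbers `([a/2ᵐ]⁺_f − [1/2ᵐ]⁺_f)/g` are integers congruent to
`stabEisCuspDiff N_W β m a / 8` modulo `2ℤ₂` — THE RESEARCH STUB —, then (★-core) holds: for all such `W, f`, every nonzero
rational multiple `L₀ ∈ Λ` of `L₂(f, α_W)` and all nonzero `Λ`-multiples `G₀, G₀^ι` of the `2`-adic Kubota–Leopoldt numerators,
`X²·red(pfree L₀) = red((1+T)^e)·red(pfree G₀)·red(pfree G₀^ι)·∏_{ℓ ∣ N_W} red(γ_ℓ − 1)^{m_ℓ}` for some `e ∈ ℤ₂`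
(`m_ℓ = 1` at multiplicative, `2` at additive primes). Proof: `starEisFin` + `sq_X_mul_red_pfree_eq_of_cuspCongruence8`.
[cite: GreenbergVatsal2000, §3 Thm. (3.12), (28)] [cite: Stevens1982, §5.4] [cite: MazurTateTeitelbaum1986Invent, §I.10–I.13] -/
theorem starCore_of_cuspCongruence8
    (hS8 : ∀ (W : WeierstrassCurve ℚ) [W.IsElliptic] [W.IsGloballyMinimal] (x : ℚ), IsOrdinaryAt W 2 →
      HasUniqueRationalTwoTorsionX W x →
      ((TwoTorsionRamifiedAtTwo x ∧ ¬ TwoTorsionOdd W x) ∨ (TwoTorsionOdd W x ∧ ¬ TwoTorsionRamifiedAtTwo x)) →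
      ∀ ⦃N : ℕ⦄ [NeZero N] (f : CuspForm (Gamma0 N) 2), IsNewformOf W f →
        ∃ β : ℕ → ℕ, IsAdmissibleStabData (W.conductorNorm ℤ) β ∧ ∃ g : ℚ, g ≠ 0 ∧
          ∀ (m : ℕ) (a : ℤ), 3 ≤ m → a % 4 = 1 → 1 < a → a < 2 ^ m →
            ∃ n : ℤ, plusCuspDiff f m a = n * g ∧
              ‖(n : ℚ_[2]) - ((stabEisCuspDiff (W.conductorNorm ℤ) β m a / 8 : ℚ) : ℚ_[2])‖ ≤ 2⁻¹)
    (W : WeierstrassCurve ℚ) [W.IsElliptic] [W.IsGloballyMinimal] (x : ℚ) (hord : IsOrdinaryAt W 2)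
    (hx : HasUniqueRationalTwoTorsionX W x)
    (hAB : (TwoTorsionRamifiedAtTwo x ∧ ¬ TwoTorsionOdd W x) ∨ (TwoTorsionOdd W x ∧ ¬ TwoTorsionRamifiedAtTwo x))
    ⦃N : ℕ⦄ [NeZero N] (f : CuspForm (Gamma0 N) 2) (hf : IsNewformOf W f)
    (c : ℚ) (L₀ : IwasawaAlgebra 2) (hL₀ : L₀ ≠ 0)
    (hι : iwasawaToPowerSeries 2 L₀ = PowerSeries.C (c : ℚ_[2]) * padicLFunction f (unitRoot W 2 : ℚ_[2]))
    (cg : ℚ_[2]) (G₀ : IwasawaAlgebra 2) (hG₀ : G₀ ≠ 0)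
    (hιG : iwasawaToPowerSeries 2 G₀ = PowerSeries.C cg * klTwoNumerator)
    (ci : ℚ_[2]) (GI₀ : IwasawaAlgebra 2) (hGI₀ : GI₀ ≠ 0)
    (hιGI : iwasawaToPowerSeries 2 GI₀ = PowerSeries.C ci * klTwoNumeratorInv) :
    ∃ e : ℤ_[2],
      PowerSeries.X ^ 2 * red (pfree L₀) =
        red (PowerSeries.binomialSeries ℤ_[2] e) * red (pfree G₀) * red (pfree GI₀) *
          ∏ ℓ ∈ (W.conductorNorm ℤ).primeFactors,
            red (frobeniusSeries 2 ℓ - 1) ^ (if (W.conductorNorm ℤ).factorization ℓ = 1 then 1 else 2) := by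
  obtain ⟨β, hadm, g, hg, hC⟩ := hS8 W x hord hx hAB f hf
  -- `N_W` is odd (good reduction at `2`)
  have h2N : ¬ 2 ∣ W.conductorNorm ℤ := not_dvd_conductorNorm_of_hasGoodReductionAtPrime W hord.1
  have hodd : Odd (W.conductorNorm ℤ) := Nat.odd_iff.mpr (Nat.two_dvd_ne_zero.mp h2N)
  -- the Eisenstein half, finite-level form
  obtain ⟨H, e₀, hH, hredH⟩ := starEisFin (W.conductorNorm ℤ) hodd β hadm cg G₀ hG₀ hιG ci GI₀ hGI₀ hιGI
  -- `red H ≠ 0`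
  have hH0 : red H ≠ 0 := by
    rw [hredH]
    refine mul_ne_zero (mul_ne_zero (mul_ne_zero ?_ (red_pfree_ne_zero hG₀)) (red_pfree_ne_zero hGI₀))
      (Finset.prod_ne_zero_iff.mpr fun ℓ hℓ ↦ pow_ne_zero _ ?_)
    · intro h
      have := order_red_binomialSeries e₀
      rw [h, PowerSeries.order_zero] at this
      exact ENat.top_ne_zero this
    · have hℓp : ℓ.Prime := Nat.prime_of_mem_primeFactors hℓ
      have hℓ2 : ℓ ≠ 2 := fun h2 ↦ h2N (h2 ▸ Nat.dvd_of_mem_primeFactors hℓ)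
      exact red_frobeniusSeries_sub_one_ne_zero_two hℓp hℓ2
  -- the glue, finite-level form
  have hglue := sq_X_mul_red_pfree_eq_of_cuspCongruence8 f hord hf (stabEisCuspDiff (W.conductorNorm ℤ) β)
    (stabEisCuspDiff_one (W.conductorNorm ℤ) β) g hg (fun m a h3 h4 h1 hlt ↦ hC m a h3 h4 h1 hlt) H
    (fun k ↦ hH k) hH0 hL₀ hι
  refine ⟨1 + e₀, ?_⟩
  have hprod : ∏ ℓ ∈ (W.conductorNorm ℤ).primeFactors,
      red (frobeniusSeries 2 ℓ - 1) ^ (W.conductorNorm ℤ).factorization ℓ =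
      ∏ ℓ ∈ (W.conductorNorm ℤ).primeFactors,
        red (frobeniusSeries 2 ℓ - 1) ^ (if (W.conductorNorm ℤ).factorization ℓ = 1 then 1 else 2) := by
    refine Finset.prod_congr rfl fun ℓ hℓ ↦ ?_
    rcases factorization_eq_one_or_two_of_admissible hadm hℓ with h1 | h2
    · rw [if_pos h1, h1]
    · rw [if_neg (by omega), h2]
  rw [hglue, hredH, PowerSeries.binomialSeries_add, red_mul', hprod]
  ring

end Summit.BirchSwinnertonDyer.BirchSwinnertonDyer.Theorems.DepletionAtTwo

end
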